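import Mathlib
import Literature.NumberTheory.Transcendental.LandauDefectLatticeTate
import Literature.RingTheory.PowerSeries.LaurentSeriesDerivation

/-!
# Crux `InverseLandauRationalCurves`, line `Sketch` — kernel helpers, IV: Tate forms and the
period functional

Helpers for the lead's stub `stub_kernel` (item stmt-KontsevichZagierPeriods-13872).

A **Tate form** over a field `K′ ⊇ k(ϖ)` is a pair `(N, m)`, `N ∈ K′[z]`, standing for
`N / Q_{K′}^m` where `Q_{K′}` is the image of the Tate denominator `Q`. The **period functional**
`I m N = Σ_i N_i ⊗ J(i, m) ∈ K′ ⊗_{k(ϖ)} k((ϖ))` (`J(i,m) = ∫₀¹ zⁱ Q^{-m} dz` expanded in `ϖ`) is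
characterised on monomials; from the four identities of the formal calculus
(`stub_tateExpansionCalculus`) we derive: absorption `I (m+1) (N·Q) = I m N`, the termwise
fundamental theorem of calculus, commutation with `d/dϖ`, and the vanishing of the period of
`P/Q` (the crux hypothesis).

Dictionary: `toParamPoly R = (swap R).map (k[ϖ] → k(ϖ))` where `swap : k[z][ϖ] → k[ϖ][z]`.
-/

noncomputable section

open Polynomial TensorProduct
open scoped LaurentSeries RatFunc
open Literature.NumberTheory.Transcendental.AyoubRel

namespace Summit.KontsevichZagierPeriods.InverseLandau.RationalCurves

section Dictionary

variable {k : Type*} [Field k]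

/-- **Dictionary.** `toParamPoly : k[z][ϖ] → k(ϖ)[z]` is the variable swap `k[z][ϖ] → k[ϖ][z]`
followed by the coefficient map `k[ϖ] → k(ϖ)`. -/
theorem toParamPoly_eq_map_swap (R : Polynomial (Polynomial k)) :
    TateFamily₁.toParamPoly R =
      (R.eval₂ (mapRingHom (C : k →+* k[X])) (C X)).map (algebraMap k[X] (RatFunc k)) := by
  have key : (TateFamily₁.toParamPoly (k := k)) =
      (mapRingHom (algebraMap k[X] (RatFunc k))).comp
        (eval₂RingHom (mapRingHom (C : k →+* k[X])) (C X)) := by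
    refine Polynomial.ringHom_ext (fun q => ?_) ?_
    · simp only [TateFamily₁.toParamPoly, coe_eval₂RingHom, eval₂_C, RingHom.coe_comp,
        Function.comp_apply, coe_mapRingHom, Polynomial.map_map]
      congr 1
    · simp only [TateFamily₁.toParamPoly, coe_eval₂RingHom, eval₂_X, RingHom.coe_comp,
        Function.comp_apply, coe_mapRingHom, map_C, RatFunc.algebraMap_X]
  exact congr_fun (congr_arg DFunLike.coe key) R

/-- Coefficients of `toParamPoly R` are the images of the coefficients of the swapped polynomial
(polynomials in `ϖ`). -/
theorem coeff_toParamPoly (R : Polynomial (Polynomial k)) (l : ℕ) :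
    (TateFamily₁.toParamPoly R).coeff l =
      algebraMap k[X] (RatFunc k) ((R.eval₂ (mapRingHom (C : k →+* k[X])) (C X)).coeff l) := by
  rw [toParamPoly_eq_map_swap, coeff_map]

/-- Evaluating `toParamPoly R` at a constant `c ∈ k` gives the image of `R(z = c) ∈ k[ϖ]`. -/
theorem eval_toParamPoly_algebraMap (R : Polynomial (Polynomial k)) (c : k) :
    (TateFamily₁.toParamPoly R).eval (algebraMap k (RatFunc k) c) =
      algebraMap k[X] (RatFunc k) (R.map (evalRingHom c)) := by
  have key : ((evalRingHom (algebraMap k (RatFunc k) c)).comp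
      (TateFamily₁.toParamPoly (k := k))) =
      (algebraMap (Polynomial k) (RatFunc k)).comp (mapRingHom (evalRingHom c)) := by
    refine Polynomial.ringHom_ext (fun q => ?_) ?_
    · simp only [RingHom.coe_comp, Function.comp_apply, coe_evalRingHom, coe_mapRingHom,
        map_C, TateFamily₁.toParamPoly, coe_eval₂RingHom, eval₂_C]
      rw [Polynomial.eval_map, ← Polynomial.aeval_def, Polynomial.aeval_algebraMap_apply,
        Polynomial.coe_aeval_eq_eval, IsScalarTower.algebraMap_apply k k[X] (RatFunc k) (eval c q),
        ← Polynomial.C_eq_algebraMap]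
    · simp only [RingHom.coe_comp, Function.comp_apply, coe_evalRingHom, coe_mapRingHom,
        map_X, TateFamily₁.toParamPoly, coe_eval₂RingHom, eval₂_X, eval_C]
      rfl
  exact congr_fun (congr_arg DFunLike.coe key) R

/-- The polynomial `Q(z = c) ∈ k[ϖ]` has constant term `c₀ ≠ 0`; in particular it is non-zero. -/
theorem coeff_zero_Q_map_evalRingHom (T : TateFamily₁ k) (c : k) :
    (T.Q.map (evalRingHom c)).coeff 0 = T.c₀ := by
  rw [coeff_map, T.coeff_Q_zero, coe_evalRingHom, eval_C]

/-- `Q(z = c) ≠ 0` in `k[ϖ]`. -/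
theorem Q_map_evalRingHom_ne_zero (T : TateFamily₁ k) (c : k) : T.Q.map (evalRingHom c) ≠ 0 := by
  intro h
  have := coeff_zero_Q_map_evalRingHom T c
  rw [h, coeff_zero] at this
  exact T.c₀_ne_zero this.symm

variable {K' : Type*} [Field K'] [Algebra (RatFunc k) K']

/-- The image of `toParamPoly R` in `K′[z]` evaluated at a constant `c ∈ k`. -/
theorem eval_map_toParamPoly (R : Polynomial (Polynomial k)) (c : k) :
    ((TateFamily₁.toParamPoly R).map (algebraMap (RatFunc k) K')).eval
        (algebraMap (RatFunc k) K' (algebraMap k (RatFunc k) c)) =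
      algebraMap (RatFunc k) K' (algebraMap k[X] (RatFunc k) (R.map (evalRingHom c))) := by
  rw [eval_map, eval₂_hom, eval_toParamPoly_algebraMap]

/-- The image `Q_{K′}` of the Tate denominator evaluated at `z = 0`. -/
theorem eval_zero_map_toParamPoly (R : Polynomial (Polynomial k)) :
    ((TateFamily₁.toParamPoly R).map (algebraMap (RatFunc k) K')).eval 0 =
      algebraMap (RatFunc k) K' (algebraMap k[X] (RatFunc k) (R.map (evalRingHom 0))) := by
  simpa only [map_zero] using eval_map_toParamPoly (K' := K') R 0

/-- The image `Q_{K′}` of the Tate denominator evaluated at `z = 1`. -/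
theorem eval_one_map_toParamPoly (R : Polynomial (Polynomial k)) :
    ((TateFamily₁.toParamPoly R).map (algebraMap (RatFunc k) K')).eval 1 =
      algebraMap (RatFunc k) K' (algebraMap k[X] (RatFunc k) (R.map (evalRingHom 1))) := by
  simpa only [map_one] using eval_map_toParamPoly (K' := K') R 1

/-- `Q_{K′}(0) ≠ 0`. -/
theorem eval_zero_QK_ne_zero (T : TateFamily₁ k) :
    ((TateFamily₁.toParamPoly T.Q).map (algebraMap (RatFunc k) K')).eval 0 ≠ 0 := by
  rw [eval_zero_map_toParamPoly, map_ne_zero_iff _ (algebraMap (RatFunc k) K').injective,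
    map_ne_zero_iff _ (IsFractionRing.injective k[X] (RatFunc k))]
  exact Q_map_evalRingHom_ne_zero T 0

/-- `Q_{K′}(1) ≠ 0`. -/
theorem eval_one_QK_ne_zero (T : TateFamily₁ k) :
    ((TateFamily₁.toParamPoly T.Q).map (algebraMap (RatFunc k) K')).eval 1 ≠ 0 := by
  rw [eval_one_map_toParamPoly, map_ne_zero_iff _ (algebraMap (RatFunc k) K').injective,
    map_ne_zero_iff _ (IsFractionRing.injective k[X] (RatFunc k))]
  exact Q_map_evalRingHom_ne_zero T 1

/-- `Q_{K′}` as a sum of monomials whose coefficients come from `k[ϖ]`. -/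
theorem map_toParamPoly_eq_sum (R : Polynomial (Polynomial k)) :
    (TateFamily₁.toParamPoly R).map (algebraMap (RatFunc k) K') =
      ∑ l ∈ (R.eval₂ (mapRingHom (C : k →+* k[X])) (C X)).support,
        C (algebraMap (RatFunc k) K' (algebraMap k[X] (RatFunc k)
          ((R.eval₂ (mapRingHom (C : k →+* k[X])) (C X)).coeff l))) * X ^ l := by
  conv_lhs => rw [toParamPoly_eq_map_swap, Polynomial.map_map,
    (R.eval₂ (mapRingHom (C : k →+* k[X])) (C X)).as_sum_support_C_mul_X_pow, Polynomial.map_sum]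
  refine Finset.sum_congr rfl fun l _ => ?_
  rw [Polynomial.map_mul, Polynomial.map_pow, map_X, map_C, RingHom.comp_apply]

/-- The `z`-derivative of `Q_{K′}` as a sum of monomials with coefficients from `k[ϖ]`. -/
theorem derivative_map_toParamPoly_eq_sum (R : Polynomial (Polynomial k)) :
    derivative ((TateFamily₁.toParamPoly R).map (algebraMap (RatFunc k) K')) =
      ∑ l ∈ (derivative (R.eval₂ (mapRingHom (C : k →+* k[X])) (C X))).support,
        C (algebraMap (RatFunc k) K' (algebraMap k[X] (RatFunc k)
          ((derivative (R.eval₂ (mapRingHom (C : k →+* k[X])) (C X))).coeff l))) * X ^ l := by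
  conv_lhs => rw [toParamPoly_eq_map_swap, Polynomial.map_map, Polynomial.derivative_map,
    (derivative (R.eval₂ (mapRingHom (C : k →+* k[X])) (C X))).as_sum_support_C_mul_X_pow,
    Polynomial.map_sum]
  refine Finset.sum_congr rfl fun l _ => ?_
  rw [Polynomial.map_mul, Polynomial.map_pow, map_X, map_C, RingHom.comp_apply]

end Dictionary

section Functional

variable {k : Type*} [Field k] (T : TateFamily₁ k) {K' : Type*} [Field K'] [Algebra (RatFunc k) K']

/-- **Existence of the period functional** `I m N = Σ_i N_i ⊗ J(i, m)`, `K′`-linear in `N`. -/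
theorem exists_periodFunctional (J : ℕ → ℕ → k⸨X⸩) :
    ∃ I : ℕ → (K'[X] →ₗ[K'] K' ⊗[RatFunc k] k⸨X⸩),
      ∀ (m i : ℕ) (a : K'), I m (monomial i a) = a ⊗ₜ J i m := by
  refine ⟨fun m => Polynomial.lsum fun i =>
    LinearMap.toSpanSingleton K' (K' ⊗[RatFunc k] k⸨X⸩) ((1 : K') ⊗ₜ J i m), fun m i a => ?_⟩
  rw [Polynomial.lsum_apply, sum_monomial_index]
  · rw [LinearMap.toSpanSingleton_apply, smul_tmul', smul_eq_mul, mul_one]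
  · exact map_zero _

/-- Scalars from `k[ϖ]` move across the tensor sign:
`(a · q) ⊗ y = a ⊗ (q · y)` with `q ∈ k[ϖ] ⊂ k(ϖ) ⊂ k((ϖ))`. -/
theorem mul_algebraMap_tmul (a : K') (q : k[X]) (y : k⸨X⸩) :
    (a * algebraMap (RatFunc k) K' (algebraMap k[X] (RatFunc k) q)) ⊗ₜ[RatFunc k] y =
      a ⊗ₜ (((q : PowerSeries k) : k⸨X⸩) * y) := by
  rw [mul_comm, ← Algebra.smul_def, smul_tmul, Algebra.smul_def, RatFunc.coe_coe]
  rfl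

/-- Natural-number scalars move across the tensor sign. -/
theorem mul_natCast_tmul (a : K') (n : ℕ) (y : k⸨X⸩) :
    (a * (n : K')) ⊗ₜ[RatFunc k] y = a ⊗ₜ ((n : k⸨X⸩) * y) := by
  have h1 : (n : K') = algebraMap (RatFunc k) K' (n : RatFunc k) := (map_natCast _ n).symm
  have h2 : (n : k⸨X⸩) = algebraMap (RatFunc k) k⸨X⸩ (n : RatFunc k) := (map_natCast _ n).symm
  rw [h1, mul_comm, ← Algebra.smul_def, smul_tmul, Algebra.smul_def, h2]

/-- `ℕ`-multiples move across the tensor sign. -/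
theorem nsmul_tmul_eq (a : K') (n : ℕ) (y : k⸨X⸩) :
    n • (a ⊗ₜ[RatFunc k] y) = a ⊗ₜ ((n : k⸨X⸩) * y) := by
  rw [← mul_natCast_tmul, ← Nat.cast_smul_eq_nsmul K', smul_tmul', smul_eq_mul, mul_comm]

variable (J : ℕ → ℕ → k⸨X⸩) (I : ℕ → (K'[X] →ₗ[K'] K' ⊗[RatFunc k] k⸨X⸩))
  (hI : ∀ (m i : ℕ) (a : K'), I m (monomial i a) = a ⊗ₜ J i m)

include hI in
/-- The period functional on `C b * X ^ i`. -/
theorem period_C_mul_X_pow (m i : ℕ) (b : K') : I m (C b * X ^ i) = b ⊗ₜ J i m := by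
  rw [C_mul_X_pow_eq_monomial, hI]

include hI in
/-- **Absorption**: `I (m+1) (N · Q_{K′}) = I m N` — from the identity
`Σ_l q_l · J(i+l, m+1) = J(i, m)` of the formal calculus. -/
theorem period_mul_QK
    (hJa : ∀ i m : ℕ, ∑ l ∈ (T.Q.eval₂ (mapRingHom (C : k →+* k[X])) (C X)).support,
      (((T.Q.eval₂ (mapRingHom (C : k →+* k[X])) (C X)).coeff l : PowerSeries k) : k⸨X⸩) *
        J (i + l) (m + 1) = J i m)
    (m : ℕ) (N : K'[X]) :
    I (m + 1) (N * (TateFamily₁.toParamPoly T.Q).map (algebraMap (RatFunc k) K')) = I m N := by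
  induction N using Polynomial.induction_on' with
  | add p q hp hq => rw [add_mul, map_add, map_add, hp, hq]
  | monomial i a =>
    rw [map_toParamPoly_eq_sum, Finset.mul_sum, map_sum, hI]
    have e : ∀ l ∈ (T.Q.eval₂ (mapRingHom (C : k →+* k[X])) (C X)).support,
        I (m + 1) (monomial i a * (C (algebraMap (RatFunc k) K' (algebraMap k[X] (RatFunc k)
          ((T.Q.eval₂ (mapRingHom (C : k →+* k[X])) (C X)).coeff l))) * X ^ l)) =
        a ⊗ₜ ((((T.Q.eval₂ (mapRingHom (C : k →+* k[X])) (C X)).coeff l : PowerSeries k) :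
          k⸨X⸩) * J (i + l) (m + 1)) := fun l _ => by
      rw [C_mul_X_pow_eq_monomial, monomial_mul_monomial, hI, mul_algebraMap_tmul]
    rw [Finset.sum_congr rfl e, ← tmul_sum, hJa]

include hI in
/-- Iterated absorption: `I (m+j) (N · Q_{K′}^j) = I m N`. -/
theorem period_mul_QK_pow
    (hJa : ∀ i m : ℕ, ∑ l ∈ (T.Q.eval₂ (mapRingHom (C : k →+* k[X])) (C X)).support,
      (((T.Q.eval₂ (mapRingHom (C : k →+* k[X])) (C X)).coeff l : PowerSeries k) : k⸨X⸩) *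
        J (i + l) (m + 1) = J i m)
    (m j : ℕ) (N : K'[X]) :
    I (m + j) (N * (TateFamily₁.toParamPoly T.Q).map (algebraMap (RatFunc k) K') ^ j) = I m N := by
  induction j with
  | zero => rw [pow_zero, mul_one, add_zero]
  | succ j ih =>
    rw [pow_succ, ← mul_assoc, ← add_assoc, period_mul_QK T J I hI hJa, ih]

include hI in
/-- **Well-definedness on rational functions**: two Tate forms representing the same rational
function have the same period. -/
theorem period_eq_of_cross_mul
    (hJa : ∀ i m : ℕ, ∑ l ∈ (T.Q.eval₂ (mapRingHom (C : k →+* k[X])) (C X)).support,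
      (((T.Q.eval₂ (mapRingHom (C : k →+* k[X])) (C X)).coeff l : PowerSeries k) : k⸨X⸩) *
        J (i + l) (m + 1) = J i m)
    {m₁ m₂ : ℕ} {N₁ N₂ : K'[X]}
    (h : N₁ * (TateFamily₁.toParamPoly T.Q).map (algebraMap (RatFunc k) K') ^ m₂ =
      N₂ * (TateFamily₁.toParamPoly T.Q).map (algebraMap (RatFunc k) K') ^ m₁) :
    I m₁ N₁ = I m₂ N₂ := by
  rw [← period_mul_QK_pow T J I hI hJa m₁ m₂ N₁, h, add_comm,
    period_mul_QK_pow T J I hI hJa m₂ m₁ N₂]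

include hI in
/-- **The crux hypothesis in functional form**: the period of `P/Q` vanishes. -/
theorem period_P_eq_zero
    (hJh : ∑ i ∈ (T.P.eval₂ (mapRingHom (C : k →+* k[X])) (C X)).support,
      (((T.P.eval₂ (mapRingHom (C : k →+* k[X])) (C X)).coeff i : PowerSeries k) : k⸨X⸩) *
        J i 1 = 0) :
    I 1 ((TateFamily₁.toParamPoly T.P).map (algebraMap (RatFunc k) K')) = 0 := by
  rw [map_toParamPoly_eq_sum, map_sum]
  have e : ∀ l ∈ (T.P.eval₂ (mapRingHom (C : k →+* k[X])) (C X)).support,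
      I 1 (C (algebraMap (RatFunc k) K' (algebraMap k[X] (RatFunc k)
        ((T.P.eval₂ (mapRingHom (C : k →+* k[X])) (C X)).coeff l))) * X ^ l) =
      (1 : K') ⊗ₜ ((((T.P.eval₂ (mapRingHom (C : k →+* k[X])) (C X)).coeff l : PowerSeries k) :
        k⸨X⸩) * J l 1) := fun l _ => by
    rw [period_C_mul_X_pow J I hI, ← one_mul (algebraMap (RatFunc k) K' _), mul_algebraMap_tmul]
  rw [Finset.sum_congr rfl e, ← tmul_sum, hJh, tmul_zero]

include hI in
/-- **Commutation with `d/dϖ`**: for the tensor derivation `D_𝕃 = D ⊗ 1 + 1 ⊗ d/dϖ`,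
`D_𝕃 (I m N) = I (m+1) (N^D · Q_{K′} - m · N · Q^D_{K′})`, where `N^D` is the coefficientwise
derivative and `Q^D_{K′}` the image of `∂Q/∂ϖ` — from the identity
`d/dϖ J(i, m) = -m Σ_l q_l′ J(i+l, m+1)`. -/
theorem period_deriv (D : K' → K') (DL : K' ⊗[RatFunc k] k⸨X⸩ →+ K' ⊗[RatFunc k] k⸨X⸩)
    (hDL : ∀ (x : K') (y : k⸨X⸩), DL (x ⊗ₜ y) = D x ⊗ₜ y + x ⊗ₜ LaurentSeries.derivative k y)
    (hD0 : D 0 = 0) (hDadd : ∀ x y, D (x + y) = D x + D y)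
    (hJa : ∀ i m : ℕ, ∑ l ∈ (T.Q.eval₂ (mapRingHom (C : k →+* k[X])) (C X)).support,
      (((T.Q.eval₂ (mapRingHom (C : k →+* k[X])) (C X)).coeff l : PowerSeries k) : k⸨X⸩) *
        J (i + l) (m + 1) = J i m)
    (hJb : ∀ i m : ℕ, LaurentSeries.derivative k (J i m) =
      -(m : k⸨X⸩) * ∑ l ∈ (T.Q.eval₂ (mapRingHom (C : k →+* k[X])) (C X)).support,
        ((derivative ((T.Q.eval₂ (mapRingHom (C : k →+* k[X])) (C X)).coeff l) : PowerSeries k) :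
          k⸨X⸩) * J (i + l) (m + 1))
    (m : ℕ) (N : K'[X]) :
    DL (I m N) = I (m + 1) (N.sum (fun i a => monomial i (D a)) *
        (TateFamily₁.toParamPoly T.Q).map (algebraMap (RatFunc k) K') -
      m • (N * ∑ l ∈ (T.Q.eval₂ (mapRingHom (C : k →+* k[X])) (C X)).support,
        C (algebraMap (RatFunc k) K' (algebraMap k[X] (RatFunc k)
          (derivative ((T.Q.eval₂ (mapRingHom (C : k →+* k[X])) (C X)).coeff l)))) * X ^ l)) := by
  have hf0 : ∀ i, (fun i a => monomial i (D a)) i 0 = (0 : K'[X]) := fun i => by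
    simp only [hD0, map_zero]
  induction N using Polynomial.induction_on' with
  | add p q hp hq =>
    rw [map_add, map_add, hp, hq, Polynomial.sum_add_index p q _ hf0 (fun i a b => by
      simp only [hDadd, map_add]), add_mul, add_mul, smul_add, ← map_add]
    congr 1
    abel
  | monomial i a =>
    rw [hI, hDL, sum_monomial_index a _ (hf0 i), map_sub, period_mul_QK T J I hI hJa, hI,
      Finset.mul_sum, map_nsmul, map_sum]
    have e : ∀ l ∈ (T.Q.eval₂ (mapRingHom (C : k →+* k[X])) (C X)).support,
        I (m + 1) (monomial i a * (C (algebraMap (RatFunc k) K' (algebraMap k[X] (RatFunc k)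
          (derivative ((T.Q.eval₂ (mapRingHom (C : k →+* k[X])) (C X)).coeff l)))) * X ^ l)) =
        a ⊗ₜ (((derivative ((T.Q.eval₂ (mapRingHom (C : k →+* k[X])) (C X)).coeff l) :
          PowerSeries k) : k⸨X⸩) * J (i + l) (m + 1)) := fun l _ => by
      rw [C_mul_X_pow_eq_monomial, monomial_mul_monomial, hI, mul_algebraMap_tmul]
    rw [Finset.sum_congr rfl e, ← tmul_sum, nsmul_tmul_eq, hJb, neg_mul, tmul_neg, sub_eq_add_neg]


omit hI in
/-- Scalars from `k(ϖ)` move across the tensor sign. -/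
theorem mul_algebraMap_ratFunc_tmul (a : K') (r : RatFunc k) (y : k⸨X⸩) :
    (a * algebraMap (RatFunc k) K' r) ⊗ₜ[RatFunc k] y = a ⊗ₜ ((r : k⸨X⸩) * y) := by
  rw [mul_comm, ← Algebra.smul_def, smul_tmul, Algebra.smul_def]

include hI in
/-- **Termwise fundamental theorem of calculus**: the period of the exact form `(M/Q_{K′}^n)′`,
i.e. of the Tate form `(M′·Q_{K′} - n·M·Q_{K′}′, n+1)`, is the boundary value
`[M/Q_{K′}^n]₀¹ ⊗ 1` — from the identity (c′) of the formal calculus. -/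
theorem period_ftc
    (hJa : ∀ i m : ℕ, ∑ l ∈ (T.Q.eval₂ (mapRingHom (C : k →+* k[X])) (C X)).support,
      (((T.Q.eval₂ (mapRingHom (C : k →+* k[X])) (C X)).coeff l : PowerSeries k) : k⸨X⸩) *
        J (i + l) (m + 1) = J i m)
    (hJc : ∀ i n : ℕ, (i : k⸨X⸩) * J (i - 1) n -
        (n : k⸨X⸩) * ∑ l ∈ (derivative (T.Q.eval₂ (mapRingHom (C : k →+* k[X])) (C X))).support,
          (((derivative (T.Q.eval₂ (mapRingHom (C : k →+* k[X])) (C X))).coeff l :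
            PowerSeries k) : k⸨X⸩) * J (i + l) (n + 1) =
        ((algebraMap (Polynomial k) (RatFunc k) (T.Q.map (evalRingHom 1)))⁻¹ ^ n : RatFunc k) -
          (if i = 0 then
            (((algebraMap (Polynomial k) (RatFunc k) (T.Q.map (evalRingHom 0)))⁻¹ ^ n :
              RatFunc k) : k⸨X⸩) else 0))
    (n : ℕ) (M : K'[X]) :
    I (n + 1) (derivative M * (TateFamily₁.toParamPoly T.Q).map (algebraMap (RatFunc k) K') -
        n • (M * derivative ((TateFamily₁.toParamPoly T.Q).map (algebraMap (RatFunc k) K')))) =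
      (M.eval 1 / ((TateFamily₁.toParamPoly T.Q).map (algebraMap (RatFunc k) K')).eval 1 ^ n -
        M.eval 0 / ((TateFamily₁.toParamPoly T.Q).map (algebraMap (RatFunc k) K')).eval 0 ^ n)
          ⊗ₜ 1 := by
  induction M using Polynomial.induction_on' with
  | add p q hp hq =>
    rw [derivative_add, add_mul, add_mul, smul_add, add_sub_add_comm, map_add, hp, hq,
      eval_add, eval_add, add_div, add_div, add_sub_add_comm, add_tmul]
  | monomial i a =>
    rw [derivative_monomial, map_sub, period_mul_QK T J I hI hJa, hI, map_nsmul,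
      derivative_map_toParamPoly_eq_sum, Finset.mul_sum, map_sum]
    have e : ∀ l ∈ (derivative (T.Q.eval₂ (mapRingHom (C : k →+* k[X])) (C X))).support,
        I (n + 1) (monomial i a * (C (algebraMap (RatFunc k) K' (algebraMap k[X] (RatFunc k)
          ((derivative (T.Q.eval₂ (mapRingHom (C : k →+* k[X])) (C X))).coeff l))) * X ^ l)) =
        a ⊗ₜ ((((derivative (T.Q.eval₂ (mapRingHom (C : k →+* k[X])) (C X))).coeff l :
          PowerSeries k) : k⸨X⸩) * J (i + l) (n + 1)) := fun l _ => by
      rw [C_mul_X_pow_eq_monomial, monomial_mul_monomial, hI, mul_algebraMap_tmul]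
    rw [Finset.sum_congr rfl e, ← tmul_sum, nsmul_tmul_eq, mul_natCast_tmul, ← tmul_sub, hJc,
      eval_monomial, eval_monomial, one_pow, mul_one, eval_one_map_toParamPoly,
      eval_zero_map_toParamPoly, tmul_sub, sub_tmul]
    congr 1
    · rw [div_eq_mul_inv, ← map_pow (algebraMap (RatFunc k) K'),
        ← map_inv₀ (algebraMap (RatFunc k) K'), ← inv_pow, mul_algebraMap_ratFunc_tmul, mul_one]
    · split_ifs with hi
      · rw [hi, pow_zero, mul_one, div_eq_mul_inv, ← map_pow (algebraMap (RatFunc k) K'),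
          ← map_inv₀ (algebraMap (RatFunc k) K'), ← inv_pow, mul_algebraMap_ratFunc_tmul, mul_one]
      · rw [zero_pow hi, mul_zero, zero_div, zero_tmul, tmul_zero]

end Functional

/-- **Registered sub-goal `kernel_forms_pack`** (packaging for the gate): existence of the
`K′`-linear period functional characterised on monomials. -/
theorem kernel_forms_pack : ∀ {k : Type*} [Field k] {K' : Type*} [Field K'] [Algebra (RatFunc k) K']
    (J : ℕ → ℕ → LaurentSeries k),
    ∃ I : ℕ → (Polynomial K' →ₗ[K'] TensorProduct (RatFunc k) K' (LaurentSeries k)),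
      ∀ (m i : ℕ) (a : K'), I m (Polynomial.monomial i a) = TensorProduct.tmul (RatFunc k) a (J i m) :=
  fun J => exists_periodFunctional J

end Summit.KontsevichZagierPeriods.InverseLandau.RationalCurves

end
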